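import Literature.MathematicalPhysics.QuantumFieldTheory.King1986.MinimizerAliasRate
import HarnessLib

/-!
# King 1986, Proposition 3.8 (3.71), SECOND LINE (the lattice DERIVATIVE `∂^η_μ`), MOMENTUM-SPACE CORE: the alias sums
# of the two-spacing difference of `a_k∂^η_μG^η_kQ_k^*` are `O(L^{−γk})` for `0 ≤ γ < 1` — the modes of (4.19) WITH the
# factor `η⁻¹{exp[iη(p′+l+m)_μ] − 1}`, bounded by `|(p′+l+m)_μ|` (p. 672), and its replacement (4.25) (p. 673)
#
# v1.0.1 (docstring erratum, declarations byte-identical): King's equation numbers corrected — the bound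
# `|η⁻¹(e^{iηq_μ} − 1)| ≦ C|q_μ|` is the UNNUMBERED display of p. 672 (after (4.21)) and the two-spacing replacement of
# this factor is (4.25) p. 673 (whose last member `C|p′+l|^{1+γ}L^{−γk}` is what `norm_fdq_two_spacing_le` proves);
# (4.26)–(4.28) concern the Hölder quotient `∂_α` and are NOT used here.  v1.0's labels «(4.26)»∕«(4.27)» for these two
# bounds and its paraphrase of p. 673 were wrong; the verbatim text is quoted below.

**Citation header (reproduction of PUBLISHED and PROVED work; seat `pub-ymgap-dag-n18-b` (g2) of the cell `pub-ymgap`,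
Track-A node N18 = NE5 whose PRINTED MODEL of record is King's Prop. 3.8 ∕ 3.9; ninth file of the seat's chain.  The
tree's `MinimizerAliasModes` ∕ `MinimizerAliasRate` (p409438 ∕ p410190) cover the FIRST line of (3.71) and list «the
Hölder-quotient and derivative lines of (3.71)» as NOT COVERED; this file covers the DERIVATIVE line's momentum-space core,
reusing the first line's four replacements as a black box and adding the fifth factor.)**
C. King, *The U(1) Higgs model. I. The continuum limit*, Commun. Math. Phys. **102** (1986) 649–677 [King1986], §3.4
Proposition 3.8 (3.71) p. 664 (second line: `|a_{k+n}∂^{η′}_μG^{η′}_{k+n}Q^*_{k+n}(x′, z) − a_k∂^η_μG^η_kQ^*_k(x, z)|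
≦ CL^{−γk}exp[−δ₀|x − z|]`), §4 p. 672 (4.19)–(4.23), p. 673 (4.24)–(4.31).  Page images READ AS IMAGES by this seat:
`b2b-balaban-template/king-renders/1986-cmp102-king-u1-higgs-I-p016-x2.png` (p. 664), `…-p024-x2.png` (p. 672).  King's
paper is TEMPLATE LITERATURE (a printed and proved `A = 0` mechanism); nothing here is about Bałaban's covariant objects.

**What King prints (verbatim, p. 672).**  «Using the representation (4.2), we shall now establish the last bound in
(3.71). The rest of Proposition 3.8 is simpler. We have the identity (∂_α(x′,y′)∂^{η′}_μa_{k+n}G^{η′}_{k+n}Q^*_{k+n})(z) =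
(2π)^{−d}∫dp′ Σ_lΣ_m e^{i(p′+l+m)(x′−z)}|x′ − y′|^{−α}{1 − exp[i(p′+l+m)(y′−x′)]}·(η)^{−1}{exp[iη′(p′+l+m)_μ] − 1}
{Δ^{(k+n)}(p′)u^{η′}_{k+n}(p′+l+m)Δ^{η′}(p′+l+m)^{−1}}, (4.19) … Also (η′)^{−1}|exp[iη′(p′+l+m)_μ] − 1| ≦ C|(p′+l+m)_μ| …
so the sum over l, m is bounded by Σ_{l,m}|p′+l+m|^{α−1}Π_μ|(p′+l+m)_μ|^{−1} ≦ C for α < 1. (4.22)  We first bound the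
terms in (4.19) with m ≠ 0 as follows: |(4.19); m ≠ 0| ≦ … ≦ CL^{−γk} for α + γ < 1. (4.23)  To analyze the m = 0 term
in (4.19), we successively replace each factor by the corresponding one in the expression for (∂_α(x,y)∂^η_μa_kG^η_kQ^*_k)(z)
and bound the error.»  p. 673: «Next, we have |(η′)^{−1}[exp[iη′(p′+l)_μ] − 1] − η^{−1}[exp[iη(p′+l)_μ] − 1]| ≦
(η′)^{−1}sin²1∕2η′(p′+l)_μ + η^{−1}sin²1∕2η(p′+l)_μ + |(η′)^{−1}sin η′(p′+l)_μ − η^{−1}sin η(p′+l)_μ| ≦ C|p′+l|²L^{−k} ≦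
C|p′+l|^{1+γ}L^{−γk}. (4.25)» (the equation numbers (4.26)–(4.28) that follow on p. 673 belong to the Hölder quotient
`∂_α` of lines 3–4 of (3.71), not used in this file).

**What this file PROVES (kernel; Mathlib + the named tree modules; the DERIVATIVE line of (3.71) WITHOUT the Hölder
quotient `∂_α`, i.e. King's `α = 0`).**  In King's momentum variables (reduced momentum `p′`, `|p′_μ| ≤ π`; aliases
`q = p′ + 2πj`; coarse spacing `η = N⁻¹`, `N = L^k`; finer spacing `η′ = (RN)⁻¹`), a DERIVATIVE MODE is
`dmodeTerm Δ η M q ξ μ = modeTerm Δ η M q ξ · D_η(−q_μ)` with `D_η(t) = η⁻¹(e^{−iηt} − 1)` the tree's `fdq`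
(`AveragingWeightRate`), so that `D_η(−q_μ) = η⁻¹(e^{iηq_μ} − 1)` is exactly King's factor in (4.19):
* §1 the fifth factor: `‖D_η(−t)‖ ≤ |t|` (p. 672, the display after (4.21); `norm_fdq_le`) and **(4.25)**, last member,
  `‖D_{η′}(−t) − D_η(−t)‖ ≤ 2^{1−γ}N^{−γ}S^{1+γ}` for `|t| ≤ S`, `0 ≤ γ ≤ 1`, `0 < η′ ≤ η = N⁻¹` (interpolation of (4.25)'s
  middle member `|η − η′|t²` = `norm_fdq_sub_fdq_le` with the p. 672 bound, `le_rpow_interp`; King trades on the zone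
  instead — same result).
* §2 `dmodeTerm`, its norm, and **THE FAR ALIASES** ((4.23) with the derivative factor): at sup-distance `≥ N` from the
  origin `‖dT(q)‖ ≤ a(π/2)^d(π²/4)·N^{−γ}·aliasTerm γ p′ k` (`dmodeTerm_far_le`: the trade `‖q‖^{−2}·|q_μ| ≤ ‖q‖^{−1} ≤
  N^{−γ}‖q‖^{γ−1}` — ONE power of the alias momentum fewer than the first line, hence the alias exponent `γ` in place
  of `γ − 1`), summed over any finite family `≤ a(π/2)^d(π²/4)·aliasConst d γ·N^{−γ}` for `γ < 1` (`sum_dmodeTerm_far_le`).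
* §3 **THE NEAR ALIASES** (`norm_dmodeTerm_sub_near_le`): `dT_B − dT_A = (T_B − T_A)·D_B + T_A·(D_B − D_A)`; the first
  line's four replacements (`MinimizerAliasRate.norm_modeTerm_sub_near_le`, BY NAME) times the p. 672 bound
  `‖D‖ ≤ |q_μ|`, plus (4.20)–(4.21) (`modeAmp_alias_le`) times (4.25): `‖dT_B − dT_A‖ ≤ (K₁′N^{−γ} + K₂δ^γ)·aliasTerm γ p′ j`, `K₁′ = dnearRateConst`,
  `K₂ = nearPosConst`.
* §4 **THE CENTRAL ALIAS** (`norm_dmodeTerm_sub_central_le`): the same with `|p′_μ| ≤ π` (`dcentralRateConst`,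
  `dcentralPosConst`).
* §5 the ASSEMBLED BOUND `alias_sums_two_spacing_deriv_le` (digit bookkeeping of `MinimizerAliasRate` §4 by name) and,
  for King's own symbols (`DeltaEff`, `lemma43_aK_rel`, `DeltaEff_le_mul_latticeSymbol_of_mass`), the END
  **`king_prop38_deriv_aliasSums`**: for `a > 0`, `L ≥ 2`, `k, n ≥ 1`, `m² > 0`, `0 ≤ γ < 1`, every coordinate `μ`, the
  alias sums of the difference of the DERIVATIVE mode families of `a_{k+n}∂^{η′}_μG_{k+n}Q^*_{k+n}` (at `x′`) and
  `a_k∂^η_μG_kQ^*_k` (at `x`, `|x′_ν − x_ν| ≤ δ`) are `≤ C₁′·L^{−γk} + C₂′·δ^γ` with `C₁′ = dprop38RateConst a a θ (π²/4)^d d γ`,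
  `C₂′ = dprop38PosConst a (π²/4)^d d γ`, `θ = lemma43Const a L k n`, uniformly in `p′`, the mass and `n`.

**NOT COVERED.**  The Hölder-quotient lines 3–4 of (3.71) (`∂_α`, (4.28)); the torus assembly of the derivative line for
the actual operators, Theorem 3.3's derivative clause and the printed shape (sequel `MinimizerTwoSpacingDeriv`); even `L`;
`A ≠ 0`.  HONEST FRAMING: King's `A = 0` scalar MODEL of the NE5 «η-rate» mechanism — template literature, explicit
functions of finitely many lattice momenta; nothing about Bałaban's covariant objects; nothing continuum ∕ mass-gap ∕ Clay;
count-neutral for the cell's 27 nodes.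
-/

noncomputable section

open Real Finset

namespace Literature.MathematicalPhysics.QuantumFieldTheory.King1986

/-! ## §1 The fifth factor `D_η(−q_μ) = η⁻¹(e^{iηq_μ} − 1)`: its size (p. 672) and the two-spacing bound (4.25) -/

/-- Zone bookkeeping: `|q_μ| ≤ πN` for all `μ` and `0 < η′ ≤ N⁻¹` give `|η′q_μ| ≤ π`. [folklore] -/
private theorem zone_of_le' {d : ℕ} {N : ℝ} (hN : 0 < N) {η' : ℝ} (hη' : 0 < η') (hη'N : η' ≤ N⁻¹)
    {q : Fin d → ℝ} (hz : ∀ μ, |q μ| ≤ π * N) (μ : Fin d) : |η' * q μ| ≤ π := by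
  rw [abs_mul, abs_of_pos hη']
  calc η' * |q μ| ≤ N⁻¹ * |q μ| := mul_le_mul_of_nonneg_right hη'N (abs_nonneg _)
    _ ≤ π := by rw [inv_mul_le_iff₀ hN, mul_comm]; exact hz μ

/-- Real interpolation: `0 ≤ A ≤ B`, `A ≤ C`, `0 ≤ γ ≤ 1` ⟹ `A ≤ B^{1−γ}C^γ`. [folklore] -/
private theorem le_rpow_interp {A B C γ : ℝ} (hA : 0 ≤ A) (hAB : A ≤ B) (hAC : A ≤ C) (hγ0 : 0 ≤ γ)
    (hγ1 : γ ≤ 1) : A ≤ B ^ (1 - γ) * C ^ γ := by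
  have hB : 0 ≤ B := hA.trans hAB
  have hsplit : A = A ^ (1 - γ) * A ^ γ := by
    rw [← Real.rpow_add' hA (by ring_nf; norm_num), show (1 - γ) + γ = 1 by ring, Real.rpow_one]
  rw [hsplit]
  exact mul_le_mul (Real.rpow_le_rpow hA hAB (by linarith)) (Real.rpow_le_rpow hA hAC hγ0)
    (Real.rpow_nonneg hA _) (Real.rpow_nonneg hB _)

/-- **«(η′)^{−1}|exp[iη′(p′+l+m)_μ] − 1| ≦ C|(p′+l+m)_μ|»** (p. 672, display after (4.21)), with `C = 1`:
`‖η⁻¹(e^{iηq_μ} − 1)‖ ≤ |q_μ|` (`D_η(−t)` is the tree's `fdq η (−t)`; `|e^{is} − 1| ≤ |s|`). [cite: King1986, p.672 (display after (4.21))] -/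
theorem norm_fdq_neg_le {η : ℝ} (hη : 0 < η) (t : ℝ) : ‖fdq η (-t)‖ ≤ |t| := by
  have h := norm_fdq_le hη (-t)
  rwa [abs_neg] at h

/-- **(4.25), last member** («≦ C|p′+l|²L^{−k} ≦ C|p′+l|^{1+γ}L^{−γk}»): for `0 < η′ ≤ η = N⁻¹`, `0 ≤ γ ≤ 1` and
`|t| ≤ S`, `0 < S`, `‖η′⁻¹(e^{iη′t} − 1) − η⁻¹(e^{iηt} − 1)‖ ≤ 2^{1−γ}·N^{−γ}·S^{1+γ}`: the difference is `≤ 2S` (each term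
`≤ |t|`, p. 672) and `≤ |η − η′|t² ≤ N⁻¹S²` ((4.25)'s middle member, `norm_fdq_sub_fdq_le`); interpolate.  (King reaches
the last member by the zone trade `|p′+l|^{1−γ} ≦ (πL^k)^{1−γ}` instead; the interpolation gives it for all `t`.)
[cite: King1986, (4.25) p.673] -/
theorem norm_fdq_two_spacing_le {N : ℝ} (hN : 0 < N) {η' : ℝ} (hη' : 0 < η') (hη'N : η' ≤ N⁻¹)
    {γ : ℝ} (hγ0 : 0 ≤ γ) (hγ1 : γ ≤ 1) {t S : ℝ} (hS : 0 < S) (htS : |t| ≤ S) :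
    ‖fdq η' (-t) - fdq N⁻¹ (-t)‖ ≤ 2 ^ (1 - γ) * N ^ (-γ) * S ^ (1 + γ) := by
  have hη : 0 < N⁻¹ := inv_pos.mpr hN
  have h1 : ‖fdq η' (-t) - fdq N⁻¹ (-t)‖ ≤ 2 * S :=
    (norm_sub_le _ _).trans (by linarith [norm_fdq_neg_le hη' t, norm_fdq_neg_le hη t])
  have h2 : ‖fdq η' (-t) - fdq N⁻¹ (-t)‖ ≤ N⁻¹ * S ^ 2 := by
    have h := norm_fdq_sub_fdq_le hη hη' (-t)
    refine h.trans ?_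
    rw [abs_of_nonneg (by linarith), neg_sq]
    have ht2 : t ^ 2 ≤ S ^ 2 := by
      rw [← sq_abs t]; exact pow_le_pow_left₀ (abs_nonneg t) htS 2
    calc (N⁻¹ - η') * t ^ 2 ≤ N⁻¹ * t ^ 2 := by
          refine mul_le_mul_of_nonneg_right (by linarith) (sq_nonneg t)
      _ ≤ N⁻¹ * S ^ 2 := mul_le_mul_of_nonneg_left ht2 hη.le
  have h3 := le_rpow_interp (norm_nonneg _) h1 h2 hγ0 hγ1
  refine h3.trans (le_of_eq ?_)
  rw [Real.mul_rpow (by norm_num) hS.le, Real.mul_rpow hη.le (sq_nonneg S), Real.inv_rpow hN.le,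
    ← Real.rpow_neg hN.le, show S ^ 2 = S ^ (2 : ℝ) by norm_cast, ← Real.rpow_mul hS.le]
  have hS2 : S ^ (1 - γ) * S ^ ((2 : ℝ) * γ) = S ^ (1 + γ) := by
    rw [← Real.rpow_add hS]; congr 1; ring
  calc (2 : ℝ) ^ (1 - γ) * S ^ (1 - γ) * (N ^ (-γ) * S ^ ((2 : ℝ) * γ))
      = 2 ^ (1 - γ) * N ^ (-γ) * (S ^ (1 - γ) * S ^ ((2 : ℝ) * γ)) := by ring
    _ = 2 ^ (1 - γ) * N ^ (-γ) * S ^ (1 + γ) := by rw [hS2]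

/-! ## §2 The derivative modes of (4.19) and the far aliases `m ≠ 0` -/

/-- ONE MODE of the Fourier representation (4.19) of the lattice DERIVATIVE `∂^η_μ` of the minimiser kernel
`a_kG^η_kQ_k^*` at the alias momentum `q = p′ + l`: the first line's mode `Δ·u^η(q)·Δ^η(q)⁻¹·e^{iq·ξ}` times King's factor
`η⁻¹{exp[iηq_μ] − 1}` (= `fdq η (−q_μ)` of `AveragingWeightRate`). [cite: King1986, (4.19) p.672] -/
def dmodeTerm {d : ℕ} (Δ η M : ℝ) (q ξ : Fin d → ℝ) (μ : Fin d) : ℂ :=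
  modeTerm Δ η M q ξ * fdq η (-(q μ))

/-- The size of a derivative mode: `‖dT‖ = (Δ·Δ^η(q)⁻¹·‖u^η(q)‖)·‖η⁻¹(e^{iηq_μ} − 1)‖` (`Δ ≥ 0`, `m² ≥ 0`).
[cite: King1986, (4.19)–(4.21) p.672] -/
theorem norm_dmodeTerm {d : ℕ} {Δ η M : ℝ} (hΔ : 0 ≤ Δ) (hM : 0 ≤ M) (q ξ : Fin d → ℝ) (μ : Fin d) :
    ‖dmodeTerm Δ η M q ξ μ‖ = modeAmp Δ η M q * ‖fdq η (-(q μ))‖ := by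
  unfold dmodeTerm
  rw [norm_mul, norm_modeTerm hΔ hM]

/-- A coordinate is bounded by the sup norm: `|q_μ| ≤ ‖q‖`. [folklore] -/
private theorem abs_coord_le_norm {d : ℕ} (q : Fin d → ℝ) (μ : Fin d) : |q μ| ≤ ‖q‖ := by
  rw [← Real.norm_eq_abs]; exact norm_le_pi_norm q μ

/-- **THE FAR ALIASES WITH THE DERIVATIVE FACTOR, termwise** ((4.23) for the second line of (3.71)): if the alias point
is at sup-distance `≥ N` from the origin (`m ≠ 0`), then for `0 ≤ Δ ≤ a`, `0 ≤ γ`,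
`‖dT(q)‖ ≤ a(π/2)^d(π²/4)·N^{−γ}·(‖q‖^{γ−1}·aliasWeight)` — (4.20)×(4.21)×`|D| ≤ |q_μ|` = `a(π/2)^d(π²/4)·W·‖q‖^{−2}·|q_μ|`
and the trade `‖q‖^{−1} = ‖q‖^{−γ}‖q‖^{γ−1} ≤ N^{−γ}‖q‖^{γ−1}`. [cite: King1986, (4.23) p.672] -/
theorem dmodeTerm_far_le {d : ℕ} {η : ℝ} (hη : 0 < η) {M Δ a : ℝ} (hM : 0 ≤ M) (hΔ : 0 ≤ Δ) (hΔa : Δ ≤ a)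
    {γ : ℝ} (hγ : 0 ≤ γ) {N : ℝ} (hN : 1 ≤ N)
    {p : Fin d → ℝ} (hp : ∀ μ, |p μ| ≤ π) {k : Fin d → ℤ} (hk : k ≠ 0)
    (hz : ∀ μ, |η * aliasPt p k μ| ≤ π) (hfar : N ≤ ‖aliasPt p k‖) (ξ : Fin d → ℝ) (μ : Fin d) :
    ‖dmodeTerm Δ η M (aliasPt p k) ξ μ‖
      ≤ a * ((π / 2) ^ d * (π ^ 2 / 4)) * N ^ (-γ) * aliasTerm γ p k := by
  set q := aliasPt p k with hq_def
  have hNpos : 0 < N := lt_of_lt_of_le one_pos hN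
  have hqpos : 0 < ‖q‖ := lt_of_lt_of_le hNpos hfar
  have ha : 0 ≤ a := hΔ.trans hΔa
  have hW : 0 ≤ aliasWeight p k := aliasWeight_nonneg p k
  have h1 := modeAmp_alias_le hη hM hΔ hp hk hz
  have h2 : ‖fdq η (-(q μ))‖ ≤ ‖q‖ := (norm_fdq_neg_le hη (q μ)).trans (abs_coord_le_norm q μ)
  -- the trade `‖q‖^{-2}·‖q‖ = ‖q‖^{-γ}·‖q‖^{γ-1} ≤ N^{-γ}‖q‖^{γ-1}`
  have htrade : ‖q‖ ^ (-2 : ℝ) * ‖q‖ ≤ N ^ (-γ) * ‖q‖ ^ (γ - 1) := by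
    have hsplit : ‖q‖ ^ (-2 : ℝ) * ‖q‖ = ‖q‖ ^ (-γ) * ‖q‖ ^ (γ - 1) := by
      rw [← Real.rpow_add_one hqpos.ne', ← Real.rpow_add hqpos]; congr 1; ring
    rw [hsplit]
    refine mul_le_mul_of_nonneg_right ?_ (Real.rpow_nonneg hqpos.le _)
    rw [Real.rpow_neg hqpos.le, Real.rpow_neg hNpos.le]
    exact inv_anti₀ (Real.rpow_pos_of_pos hNpos γ) (Real.rpow_le_rpow hNpos.le hfar hγ)
  rw [norm_dmodeTerm hΔ hM]
  unfold aliasTerm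
  calc modeAmp Δ η M q * ‖fdq η (-(q μ))‖
      ≤ (Δ * (π ^ 2 / 4 * ‖q‖ ^ (-2 : ℝ)) * ((π / 2) ^ d * aliasWeight p k)) * ‖q‖ :=
        mul_le_mul h1 h2 (norm_nonneg _) (by positivity)
    _ = Δ * ((π / 2) ^ d * (π ^ 2 / 4)) * (‖q‖ ^ (-2 : ℝ) * ‖q‖) * aliasWeight p k := by ring
    _ ≤ a * ((π / 2) ^ d * (π ^ 2 / 4)) * (N ^ (-γ) * ‖q‖ ^ (γ - 1)) * aliasWeight p k := by
        gcongr
    _ = a * ((π / 2) ^ d * (π ^ 2 / 4)) * N ^ (-γ) * (‖q‖ ^ (γ - 1) * aliasWeight p k) := by ring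

/-- **(4.23) with the derivative factor, summed**: over any finite family `Λ` of nonzero aliases at sup-distance `≥ N`
from the origin and in the zone of `η`, `Σ_{k∈Λ} ‖dT(q_k)‖ ≤ a(π/2)^d(π²/4)·C(d, γ)·N^{−γ}` for `0 ≤ γ < 1` — the alias
sum (4.22) with `α = γ` (`alias_sum_le_of_subset`), which is where King's «α + γ < 1» (here `α = 0`) enters.
[cite: King1986, (4.22)–(4.23) p.672] -/
theorem sum_dmodeTerm_far_le {d : ℕ} (hd : 0 < d) {η : ℝ} (hη : 0 < η) {M Δ a : ℝ} (hM : 0 ≤ M) (hΔ : 0 ≤ Δ)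
    (hΔa : Δ ≤ a) {γ : ℝ} (hγ : 0 ≤ γ) (hγ1 : γ < 1) {N : ℝ} (hN : 1 ≤ N)
    {p : Fin d → ℝ} (hp : ∀ μ, |p μ| ≤ π) {Λ : Finset (Fin d → ℤ)} (h0 : (0 : Fin d → ℤ) ∉ Λ)
    (hz : ∀ k ∈ Λ, ∀ μ, |η * aliasPt p k μ| ≤ π) (hfar : ∀ k ∈ Λ, N ≤ ‖aliasPt p k‖)
    (ξ : Fin d → ℝ) (μ : Fin d) :
    ∑ k ∈ Λ, ‖dmodeTerm Δ η M (aliasPt p k) ξ μ‖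
      ≤ a * ((π / 2) ^ d * (π ^ 2 / 4)) * N ^ (-γ) * aliasConst d γ := by
  have ha : 0 ≤ a := hΔ.trans hΔa
  have hNpos : 0 < N := lt_of_lt_of_le one_pos hN
  calc ∑ k ∈ Λ, ‖dmodeTerm Δ η M (aliasPt p k) ξ μ‖
      ≤ ∑ k ∈ Λ, a * ((π / 2) ^ d * (π ^ 2 / 4)) * N ^ (-γ) * aliasTerm γ p k := by
        refine Finset.sum_le_sum fun k hk => ?_
        have hk0 : k ≠ 0 := fun h => h0 (h ▸ hk)
        exact dmodeTerm_far_le hη hM hΔ hΔa hγ hN hp hk0 (hz k hk) (hfar k hk) ξ μ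
    _ = a * ((π / 2) ^ d * (π ^ 2 / 4)) * N ^ (-γ) * ∑ k ∈ Λ, aliasTerm γ p k := by
        rw [Finset.mul_sum]
    _ ≤ a * ((π / 2) ^ d * (π ^ 2 / 4)) * N ^ (-γ) * aliasConst d γ := by
        refine mul_le_mul_of_nonneg_left (alias_sum_le_of_subset hd hγ1 hp h0) ?_
        exact mul_nonneg (mul_nonneg ha (by positivity)) (Real.rpow_nonneg (le_of_lt hNpos) _)

/-! ## §3 The near aliases `m = 0`, `l ≠ 0`: the first line's four replacements times `|D| ≤ |q_μ|`, plus (4.25) -/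

/-- The rate constant of one near alias for the derivative line: the first line's `nearRateConst` (four replacements,
now multiplied by `‖D‖ ≤ ‖q‖`) plus `a(π/2)^d(π²/4)·2^{1−γ}` (the fifth replacement (4.25) against (4.20)–(4.21)).
[cite: King1986, (4.24)–(4.31) p.673] -/
def dnearRateConst (aA θ : ℝ) (d : ℕ) (γ : ℝ) : ℝ :=
  nearRateConst aA θ d γ + aA * ((π / 2) ^ d * (π ^ 2 / 4)) * 2 ^ (1 - γ)

/-- For a nonzero alias the exponents shift by one: `aliasTerm (γ−1) p j · ‖q‖ = aliasTerm γ p j`. [folklore] -/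
private theorem aliasTerm_mul_norm {d : ℕ} {γ : ℝ} {p : Fin d → ℝ} (hp : ∀ μ, |p μ| ≤ π) {j : Fin d → ℤ}
    (hj : j ≠ 0) : aliasTerm (γ - 1) p j * ‖aliasPt p j‖ = aliasTerm γ p j := by
  have hqpos : 0 < ‖aliasPt p j‖ := lt_of_lt_of_le one_pos (one_le_norm_aliasPt hp hj)
  unfold aliasTerm
  rw [mul_right_comm, ← Real.rpow_add_one hqpos.ne']
  congr 2; ring

/-- **THE NEAR ALIASES OF THE DERIVATIVE LINE, termwise** (p. 673, «every term in (4.19) for m = 0 can be replaced»,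
now with five factors): for a nonzero alias `q = p′ + 2πj` in the zone `|q_ν| ≤ πN`, `0 < η′ ≤ η = N⁻¹`, effective symbols
`0 ≤ Δ_A ≤ a`, `|Δ_B − Δ_A| ≤ θN⁻²Δ_A` (Lemma 4.3) and positions `|ξ′_ν − ξ_ν| ≤ δ`:
`‖dT_B − dT_A‖ ≤ (K₁′N^{−γ} + K₂δ^γ)·‖q‖^{γ−1}·aliasWeight`, `0 ≤ γ ≤ 1`, `K₁′ = dnearRateConst a θ d γ`,
`K₂ = nearPosConst a d γ` — `dT_B − dT_A = (T_B − T_A)D_B + T_A(D_B − D_A)` with the first line's bound for `T_B − T_A`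
(`norm_modeTerm_sub_near_le`), `‖D_B‖ ≤ ‖q‖` (p. 672), (4.20)–(4.21) for `T_A` (`modeAmp_alias_le`) and (4.25) for
`D_B − D_A`.
[cite: King1986, (4.24)–(4.31) p.673] -/
theorem norm_dmodeTerm_sub_near_le {d : ℕ} {N : ℝ} (hN : 1 ≤ N) {η' : ℝ} (hη' : 0 < η') (hη'N : η' ≤ N⁻¹)
    {M : ℝ} (hM : 0 ≤ M) {γ : ℝ} (hγ0 : 0 ≤ γ) (hγ1 : γ ≤ 1)
    {ΔA ΔB aA θ : ℝ} (hΔA : 0 ≤ ΔA) (hΔAa : ΔA ≤ aA) (hθ : 0 ≤ θ)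
    (h43 : |ΔB - ΔA| ≤ θ * (N ^ 2)⁻¹ * ΔA)
    {p : Fin d → ℝ} (hp : ∀ μ, |p μ| ≤ π) {j : Fin d → ℤ} (hj : j ≠ 0)
    (hz : ∀ μ, |aliasPt p j μ| ≤ π * N)
    {ξ ξ' : Fin d → ℝ} {δ : ℝ} (hδ : 0 ≤ δ) (hξ : ∀ μ, |ξ' μ - ξ μ| ≤ δ) (μ : Fin d) :
    ‖dmodeTerm ΔB η' M (aliasPt p j) ξ' μ - dmodeTerm ΔA N⁻¹ M (aliasPt p j) ξ μ‖
      ≤ (dnearRateConst aA θ d γ * N ^ (-γ) + nearPosConst aA d γ * δ ^ γ) * aliasTerm γ p j := by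
  set q := aliasPt p j with hq_def
  set W := aliasWeight p j with hW_def
  set TA := modeTerm ΔA N⁻¹ M q ξ with hTA_def
  set TB := modeTerm ΔB η' M q ξ' with hTB_def
  set DA := fdq N⁻¹ (-(q μ)) with hDA_def
  set DB := fdq η' (-(q μ)) with hDB_def
  have hNpos : 0 < N := lt_of_lt_of_le one_pos hN
  have hη : 0 < N⁻¹ := inv_pos.mpr hNpos
  have hq1 : 1 ≤ ‖q‖ := one_le_norm_aliasPt hp hj
  have hqpos : 0 < ‖q‖ := lt_of_lt_of_le one_pos hq1
  have hzA : ∀ ν, |N⁻¹ * q ν| ≤ π := zone_of_le' hNpos hη le_rfl hz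
  have haA : 0 ≤ aA := hΔA.trans hΔAa
  have hW0 : 0 ≤ W := aliasWeight_nonneg p j
  have hNγ : 0 ≤ N ^ (-γ) := Real.rpow_nonneg hNpos.le _
  have hδγ : 0 ≤ δ ^ γ := Real.rpow_nonneg hδ _
  -- the four factor bounds
  have h1 : ‖TB - TA‖ ≤ (nearRateConst aA θ d γ * N ^ (-γ) + nearPosConst aA d γ * δ ^ γ)
      * aliasTerm (γ - 1) p j :=
    norm_modeTerm_sub_near_le hN hη' hη'N hM hγ0 hγ1 hΔA hΔAa hθ h43 hp hj hz hδ hξ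
  have h2 : ‖DB‖ ≤ ‖q‖ := (norm_fdq_neg_le hη' (q μ)).trans (abs_coord_le_norm q μ)
  have h3 : ‖TA‖ ≤ aA * (π ^ 2 / 4 * ‖q‖ ^ (-2 : ℝ)) * ((π / 2) ^ d * W) := by
    rw [hTA_def, norm_modeTerm hΔA hM]
    exact (modeAmp_alias_le hη hM hΔA hp hj hzA).trans
      (mul_le_mul_of_nonneg_right (mul_le_mul_of_nonneg_right hΔAa (by positivity)) (by positivity))
  have h4 : ‖DB - DA‖ ≤ 2 ^ (1 - γ) * N ^ (-γ) * ‖q‖ ^ (1 + γ) :=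
    norm_fdq_two_spacing_le hNpos hη' hη'N hγ0 hγ1 hqpos (abs_coord_le_norm q μ)
  -- nonnegativity of the constants
  have hK1 : 0 ≤ nearRateConst aA θ d γ := by unfold nearRateConst; positivity
  have hK2 : 0 ≤ nearPosConst aA d γ := by unfold nearPosConst; positivity
  have hKK : 0 ≤ nearRateConst aA θ d γ * N ^ (-γ) + nearPosConst aA d γ * δ ^ γ := by positivity
  have hAT : 0 ≤ aliasTerm (γ - 1) p j := aliasTerm_nonneg _ p j
  -- the telescoping `dT_B − dT_A = (T_B − T_A)·D_B + T_A·(D_B − D_A)`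
  have hid : dmodeTerm ΔB η' M q ξ' μ - dmodeTerm ΔA N⁻¹ M q ξ μ = (TB - TA) * DB + TA * (DB - DA) := by
    simp only [dmodeTerm, hTA_def, hTB_def, hDA_def, hDB_def]; ring
  rw [hid]
  have hT1 : ‖(TB - TA) * DB‖
      ≤ (nearRateConst aA θ d γ * N ^ (-γ) + nearPosConst aA d γ * δ ^ γ) * aliasTerm γ p j := by
    rw [norm_mul]
    calc ‖TB - TA‖ * ‖DB‖
        ≤ ((nearRateConst aA θ d γ * N ^ (-γ) + nearPosConst aA d γ * δ ^ γ) * aliasTerm (γ - 1) p j) * ‖q‖ :=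
          mul_le_mul h1 h2 (norm_nonneg _) (mul_nonneg hKK hAT)
      _ = (nearRateConst aA θ d γ * N ^ (-γ) + nearPosConst aA d γ * δ ^ γ) * aliasTerm γ p j := by
          rw [mul_assoc, aliasTerm_mul_norm hp hj]
  have hT2 : ‖TA * (DB - DA)‖
      ≤ aA * ((π / 2) ^ d * (π ^ 2 / 4)) * 2 ^ (1 - γ) * N ^ (-γ) * aliasTerm γ p j := by
    rw [norm_mul]
    have hpow : ‖q‖ ^ (-2 : ℝ) * ‖q‖ ^ (1 + γ) = ‖q‖ ^ (γ - 1) := by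
      rw [← Real.rpow_add hqpos]; congr 1; ring
    calc ‖TA‖ * ‖DB - DA‖
        ≤ (aA * (π ^ 2 / 4 * ‖q‖ ^ (-2 : ℝ)) * ((π / 2) ^ d * W)) * (2 ^ (1 - γ) * N ^ (-γ) * ‖q‖ ^ (1 + γ)) :=
          mul_le_mul h3 h4 (norm_nonneg _) (by positivity)
      _ = aA * ((π / 2) ^ d * (π ^ 2 / 4)) * 2 ^ (1 - γ) * N ^ (-γ)
            * ((‖q‖ ^ (-2 : ℝ) * ‖q‖ ^ (1 + γ)) * W) := by ring
      _ = aA * ((π / 2) ^ d * (π ^ 2 / 4)) * 2 ^ (1 - γ) * N ^ (-γ) * aliasTerm γ p j := by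
          rw [hpow]; rfl
  calc ‖(TB - TA) * DB + TA * (DB - DA)‖ ≤ ‖(TB - TA) * DB‖ + ‖TA * (DB - DA)‖ := norm_add_le _ _
    _ ≤ (nearRateConst aA θ d γ * N ^ (-γ) + nearPosConst aA d γ * δ ^ γ) * aliasTerm γ p j
        + aA * ((π / 2) ^ d * (π ^ 2 / 4)) * 2 ^ (1 - γ) * N ^ (-γ) * aliasTerm γ p j := add_le_add hT1 hT2
    _ = (dnearRateConst aA θ d γ * N ^ (-γ) + nearPosConst aA d γ * δ ^ γ) * aliasTerm γ p j := by
        unfold dnearRateConst; ring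

/-! ## §4 The central alias `l = 0` -/

/-- Rate constant of the central alias for the derivative line: `π·centralRateConst` (the first line's three
replacements times `‖D‖ ≤ |p′_μ| ≤ π`) `+ K(π²/4)(π/2)^d·2^{1−γ}π²` ((4.25) at `|p′_μ| ≤ π`, `π^{1+γ} ≤ π²`).
[cite: King1986, (4.24)–(4.31) p.673] -/
def dcentralRateConst (aA θ K : ℝ) (d : ℕ) (γ : ℝ) : ℝ :=
  π * centralRateConst aA θ K d γ + K * (π ^ 2 / 4) * (π / 2) ^ d * 2 ^ (1 - γ) * π ^ 2

/-- Position constant of the central alias for the derivative line: `π·centralPosConst`. [cite: King1986, (4.24) p.673] -/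
def dcentralPosConst (K : ℝ) (d : ℕ) (γ : ℝ) : ℝ :=
  π * centralPosConst K d γ

/-- **THE CENTRAL ALIAS OF THE DERIVATIVE LINE** (`q = p′`, `|p′_μ| ≤ π`): with the input `Δ_A ≤ K·Δ^η(p′)` ((4.21) at
`l = 0`), `‖dT_B − dT_A‖ ≤ K′_{c1}·N^{−γ} + K′_{c2}·δ^γ` — the first line's central bound (`norm_modeTerm_sub_central_le`)
times `‖D_B‖ ≤ |p′_μ| ≤ π`, plus `‖T_A‖ ≤ K(π²/4)(π/2)^d` (`central_ratio_le`, `norm_uWeight_le`) times (4.25) at `S = π`.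
[cite: King1986, (4.24)–(4.31) p.673] -/
theorem norm_dmodeTerm_sub_central_le {d : ℕ} {N : ℝ} (hN : 1 ≤ N) {η' : ℝ} (hη' : 0 < η') (hη'N : η' ≤ N⁻¹)
    {M : ℝ} (hM : 0 ≤ M) {γ : ℝ} (hγ0 : 0 ≤ γ) (hγ1 : γ ≤ 1)
    {ΔA ΔB aA θ K : ℝ} (hΔA : 0 ≤ ΔA) (hΔAa : ΔA ≤ aA) (hθ : 0 ≤ θ) (hK : 0 ≤ K)
    (h43 : |ΔB - ΔA| ≤ θ * (N ^ 2)⁻¹ * ΔA)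
    {p : Fin d → ℝ} (hp : ∀ μ, |p μ| ≤ π) (hcen : ΔA ≤ K * latticeSymbol N⁻¹ M p)
    {ξ ξ' : Fin d → ℝ} {δ : ℝ} (hδ : 0 ≤ δ) (hξ : ∀ μ, |ξ' μ - ξ μ| ≤ δ) (μ : Fin d) :
    ‖dmodeTerm ΔB η' M p ξ' μ - dmodeTerm ΔA N⁻¹ M p ξ μ‖
      ≤ dcentralRateConst aA θ K d γ * N ^ (-γ) + dcentralPosConst K d γ * δ ^ γ := by
  set TA := modeTerm ΔA N⁻¹ M p ξ with hTA_def
  set TB := modeTerm ΔB η' M p ξ' with hTB_def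
  set DA := fdq N⁻¹ (-(p μ)) with hDA_def
  set DB := fdq η' (-(p μ)) with hDB_def
  have hNpos : 0 < N := lt_of_lt_of_le one_pos hN
  have hη : 0 < N⁻¹ := inv_pos.mpr hNpos
  have hz : ∀ ν, |p ν| ≤ π * N := fun ν => (hp ν).trans (by nlinarith [Real.pi_pos])
  have hzA : ∀ ν, |N⁻¹ * p ν| ≤ π := zone_of_le' hNpos hη le_rfl hz
  have haA : 0 ≤ aA := hΔA.trans hΔAa
  have hNγ : 0 ≤ N ^ (-γ) := Real.rpow_nonneg hNpos.le _
  have hδγ : 0 ≤ δ ^ γ := Real.rpow_nonneg hδ _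
  have hπ1 : (1 : ℝ) ≤ π := by linarith [Real.pi_gt_three]
  -- the four factor bounds
  have h1 : ‖TB - TA‖ ≤ centralRateConst aA θ K d γ * N ^ (-γ) + centralPosConst K d γ * δ ^ γ :=
    norm_modeTerm_sub_central_le hN hη' hη'N hM hγ0 hγ1 hΔA hΔAa hθ hK h43 hp hcen hδ hξ
  have h2 : ‖DB‖ ≤ π := (norm_fdq_neg_le hη' (p μ)).trans (hp μ)
  have h3 : ‖TA‖ ≤ K * (π ^ 2 / 4) * (π / 2) ^ d := by
    rw [hTA_def, norm_modeTerm hΔA hM]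
    unfold modeAmp
    exact mul_le_mul (central_ratio_le hη.ne' hη.ne' hM hK hzA hcen) (norm_uWeight_le hη hzA)
      (norm_nonneg _) (by positivity)
  have h4 : ‖DB - DA‖ ≤ 2 ^ (1 - γ) * N ^ (-γ) * π ^ 2 := by
    have h := norm_fdq_two_spacing_le hNpos hη' hη'N hγ0 hγ1 Real.pi_pos (hp μ)
    refine h.trans (mul_le_mul_of_nonneg_left ?_ (by positivity))
    calc π ^ (1 + γ) ≤ π ^ (2 : ℝ) := Real.rpow_le_rpow_of_exponent_le hπ1 (by linarith)
      _ = π ^ 2 := by norm_cast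
  have hc1 : 0 ≤ centralRateConst aA θ K d γ := by unfold centralRateConst; positivity
  have hc2 : 0 ≤ centralPosConst K d γ := by unfold centralPosConst; positivity
  -- telescoping
  have hid : dmodeTerm ΔB η' M p ξ' μ - dmodeTerm ΔA N⁻¹ M p ξ μ = (TB - TA) * DB + TA * (DB - DA) := by
    simp only [dmodeTerm, hTA_def, hTB_def, hDA_def, hDB_def]; ring
  rw [hid]
  have hT1 : ‖(TB - TA) * DB‖ ≤ (centralRateConst aA θ K d γ * N ^ (-γ) + centralPosConst K d γ * δ ^ γ) * π := by
    rw [norm_mul]; exact mul_le_mul h1 h2 (norm_nonneg _) (by positivity)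
  have hT2 : ‖TA * (DB - DA)‖ ≤ (K * (π ^ 2 / 4) * (π / 2) ^ d) * (2 ^ (1 - γ) * N ^ (-γ) * π ^ 2) := by
    rw [norm_mul]; exact mul_le_mul h3 h4 (norm_nonneg _) (by positivity)
  calc ‖(TB - TA) * DB + TA * (DB - DA)‖ ≤ ‖(TB - TA) * DB‖ + ‖TA * (DB - DA)‖ := norm_add_le _ _
    _ ≤ (centralRateConst aA θ K d γ * N ^ (-γ) + centralPosConst K d γ * δ ^ γ) * π
        + (K * (π ^ 2 / 4) * (π / 2) ^ d) * (2 ^ (1 - γ) * N ^ (-γ) * π ^ 2) := add_le_add hT1 hT2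
    _ = dcentralRateConst aA θ K d γ * N ^ (-γ) + dcentralPosConst K d γ * δ ^ γ := by
        unfold dcentralRateConst dcentralPosConst; ring

/-! ## §5 The assembled bound and King's own symbols -/

/-- Rate constant of the assembled derivative-line bound: far part + near part × `C(d, γ)` + central part.
[cite: King1986, Prop. 3.8 p.664 with (4.22)–(4.31) pp.672–673] -/
def dprop38RateConst (aA aB θ K : ℝ) (d : ℕ) (γ : ℝ) : ℝ :=
  aB * ((π / 2) ^ d * (π ^ 2 / 4)) * aliasConst d γ + dnearRateConst aA θ d γ * aliasConst d γ
    + dcentralRateConst aA θ K d γ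

/-- Position constant of the assembled derivative-line bound: near part × `C(d, γ)` + central part.
[cite: King1986, Prop. 3.8 p.664 with (4.24) p.673] -/
def dprop38PosConst (aA K : ℝ) (d : ℕ) (γ : ℝ) : ℝ :=
  nearPosConst aA d γ * aliasConst d γ + dcentralPosConst K d γ

/-- `p′ + 2π·0 = p′`. [folklore] -/
private theorem aliasPt_zero' {d : ℕ} (p : Fin d → ℝ) : aliasPt p 0 = p := by
  funext μ; simp [aliasPt]

/-- **KING'S PROPOSITION 3.8, MOMENTUM-SPACE CORE, SECOND LINE OF (3.71) (the derivative `∂^η_μ`).**  Fix the reduced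
momentum `p′` (`|p′_ν| ≤ π`), `N` (`= L^k`, `η = N⁻¹`), `R` (`= L^n`, `η′ = (RN)⁻¹`), digit sets `J` (`2|j_ν| < N`) and `B`
(`2|b_ν| < R`), effective symbols `0 ≤ Δ_A ≤ a_A`, `0 ≤ Δ_B ≤ a_B` with `|Δ_B − Δ_A| ≤ θN⁻²Δ_A` and `Δ_A ≤ KΔ^η(p′)`, two
positions with `|ξ′_ν − ξ_ν| ≤ δ`, and a coordinate `μ`.  Then the alias sums of the difference of the DERIVATIVE mode
families obey `Σ_{j∈J}Σ_{b∈B∖0}‖dT_B(j+Nb)‖ + Σ_{j∈J}‖dT_B(j) − dT_A(j)‖ ≤ C₁′·N^{−γ} + C₂′·δ^γ` for `0 ≤ γ < 1`, `d ≥ 1`,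
uniformly in `p′`, the mass `M ≥ 0` and `R` — King's «|(4.19); m ≠ 0| ≦ CL^{−γk} for α + γ < 1» (`α = 0`) plus the
replacements of every `m = 0` term; on a torus the `p′`-integral is a finite average and Theorem 3.3 supplies the
exponential factor (sequel). [cite: King1986, Prop. 3.8 (3.71) p.664; (4.19)–(4.31) pp.672–674] -/
theorem alias_sums_two_spacing_deriv_le {d : ℕ} (hd : 0 < d) {N R : ℕ} (hN : 1 ≤ N) (hR : 1 ≤ R)
    {M : ℝ} (hM : 0 ≤ M) {γ : ℝ} (hγ0 : 0 ≤ γ) (hγ1 : γ < 1)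
    {ΔA ΔB aA aB θ K : ℝ} (hΔA : 0 ≤ ΔA) (hΔAa : ΔA ≤ aA) (hΔB : 0 ≤ ΔB) (hΔBa : ΔB ≤ aB)
    (hθ : 0 ≤ θ) (hK : 0 ≤ K) (h43 : |ΔB - ΔA| ≤ θ * ((N : ℝ) ^ 2)⁻¹ * ΔA)
    {p : Fin d → ℝ} (hp : ∀ μ, |p μ| ≤ π) (hcen : ΔA ≤ K * latticeSymbol (N : ℝ)⁻¹ M p)
    {J B : Finset (Fin d → ℤ)} (hJ : ∀ j ∈ J, ∀ μ, 2 * |j μ| < (N : ℤ))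
    (hB : ∀ b ∈ B, ∀ μ, 2 * |b μ| < (R : ℤ))
    {ξ ξ' : Fin d → ℝ} {δ : ℝ} (hδ : 0 ≤ δ) (hξ : ∀ μ, |ξ' μ - ξ μ| ≤ δ) (μ : Fin d) :
    (∑ j ∈ J, ∑ b ∈ B.erase 0, ‖dmodeTerm ΔB ((R : ℝ) * N)⁻¹ M (aliasPt p (j + (N : ℤ) • b)) ξ' μ‖)
      + ∑ j ∈ J, ‖dmodeTerm ΔB ((R : ℝ) * N)⁻¹ M (aliasPt p j) ξ' μ - dmodeTerm ΔA (N : ℝ)⁻¹ M (aliasPt p j) ξ μ‖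
      ≤ dprop38RateConst aA aB θ K d γ * (N : ℝ) ^ (-γ) + dprop38PosConst aA K d γ * δ ^ γ := by
  have hNr : (1 : ℝ) ≤ N := by exact_mod_cast hN
  have hRr : (1 : ℝ) ≤ R := by exact_mod_cast hR
  have hNpos : (0 : ℝ) < N := by linarith
  have hηB : 0 < ((R : ℝ) * N)⁻¹ := by positivity
  have hηBA : ((R : ℝ) * N)⁻¹ ≤ (N : ℝ)⁻¹ := by
    rw [mul_inv]; exact mul_le_of_le_one_left (inv_nonneg.mpr hNpos.le) (inv_le_one_of_one_le₀ hRr)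
  have hNγ : 0 ≤ (N : ℝ) ^ (-γ) := Real.rpow_nonneg hNpos.le _
  have hδγ : 0 ≤ δ ^ γ := Real.rpow_nonneg hδ _
  have haA : 0 ≤ aA := hΔA.trans hΔAa
  have haB : 0 ≤ aB := hΔB.trans hΔBa
  have hAC : 0 ≤ aliasConst d γ :=
    (Finset.sum_nonneg fun k _ => aliasTerm_nonneg γ p k).trans
      (alias_sum_le_of_subset hd hγ1 hp (Finset.notMem_empty 0))
  -- FAR PART
  set Λ : Finset (Fin d → ℤ) := (J ×ˢ B.erase 0).image (fun jb => jb.1 + (N : ℤ) • jb.2) with hΛ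
  have hinj : Set.InjOn (fun jb : (Fin d → ℤ) × (Fin d → ℤ) => jb.1 + (N : ℤ) • jb.2) ↑(J ×ˢ B.erase 0) := by
    rintro ⟨j, b⟩ hjb ⟨j', b'⟩ hjb' h
    simp only [Finset.coe_product, Set.mem_prod, Finset.mem_coe] at hjb hjb'
    obtain ⟨h1, h2⟩ := digits_injective_pi (hJ j hjb.1) (hJ j' hjb'.1) h
    exact Prod.ext h1 h2
  have hfar : ∑ j ∈ J, ∑ b ∈ B.erase 0, ‖dmodeTerm ΔB ((R : ℝ) * N)⁻¹ M (aliasPt p (j + (N : ℤ) • b)) ξ' μ‖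
      ≤ aB * ((π / 2) ^ d * (π ^ 2 / 4)) * (N : ℝ) ^ (-γ) * aliasConst d γ := by
    rw [← Finset.sum_product (s := J) (t := B.erase 0)
      (f := fun jb => ‖dmodeTerm ΔB ((R : ℝ) * N)⁻¹ M (aliasPt p (jb.1 + (N : ℤ) • jb.2)) ξ' μ‖)]
    have himg : ∑ jb ∈ J ×ˢ B.erase 0, ‖dmodeTerm ΔB ((R : ℝ) * N)⁻¹ M (aliasPt p (jb.1 + (N : ℤ) • jb.2)) ξ' μ‖
        = ∑ k ∈ Λ, ‖dmodeTerm ΔB ((R : ℝ) * N)⁻¹ M (aliasPt p k) ξ' μ‖ :=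
      (Finset.sum_image (f := fun k => ‖dmodeTerm ΔB ((R : ℝ) * N)⁻¹ M (aliasPt p k) ξ' μ‖) hinj).symm
    rw [himg]
    refine sum_dmodeTerm_far_le hd hηB hM hΔB hΔBa hγ0 hγ1 hNr hp ?_ ?_ ?_ ξ' μ
    · intro h0
      rw [Finset.mem_image] at h0
      obtain ⟨⟨j, b⟩, hjb, hk⟩ := h0
      rw [Finset.mem_product, Finset.mem_erase] at hjb
      exact combo_ne_zero (hJ j hjb.1) hjb.2.1 hk
    · intro k hk ν
      rw [Finset.mem_image] at hk
      obtain ⟨⟨j, b⟩, hjb, rfl⟩ := hk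
      rw [Finset.mem_product, Finset.mem_erase] at hjb
      exact zone_of_le' (mul_pos (by linarith) hNpos) hηB le_rfl
        (zoneB_of_digits hp (hJ j hjb.1) (hB b hjb.2.2)) ν
    · intro k hk
      rw [Finset.mem_image] at hk
      obtain ⟨⟨j, b⟩, hjb, rfl⟩ := hk
      rw [Finset.mem_product, Finset.mem_erase] at hjb
      exact far_of_digits hp (hJ j hjb.1) hjb.2.1
  -- NEAR PART (j ≠ 0) and CENTRAL PART
  set g : (Fin d → ℤ) → ℝ := fun j =>
    ‖dmodeTerm ΔB ((R : ℝ) * N)⁻¹ M (aliasPt p j) ξ' μ - dmodeTerm ΔA (N : ℝ)⁻¹ M (aliasPt p j) ξ μ‖ with hg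
  have hg0 : ∀ j, 0 ≤ g j := fun j => norm_nonneg _
  have hK1 : 0 ≤ dnearRateConst aA θ d γ := by unfold dnearRateConst nearRateConst; positivity
  have hK2 : 0 ≤ nearPosConst aA d γ := by unfold nearPosConst; positivity
  have hnear : ∑ j ∈ J.erase 0, g j
      ≤ (dnearRateConst aA θ d γ * (N : ℝ) ^ (-γ) + nearPosConst aA d γ * δ ^ γ) * aliasConst d γ := by
    calc ∑ j ∈ J.erase 0, g j
        ≤ ∑ j ∈ J.erase 0, (dnearRateConst aA θ d γ * (N : ℝ) ^ (-γ) + nearPosConst aA d γ * δ ^ γ)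
            * aliasTerm γ p j := by
          refine Finset.sum_le_sum fun j hj => ?_
          rw [Finset.mem_erase] at hj
          exact norm_dmodeTerm_sub_near_le hNr hηB hηBA hM hγ0 hγ1.le hΔA hΔAa hθ h43 hp hj.1
            (zoneA_of_digit hp (hJ j hj.2)) hδ hξ μ
      _ = (dnearRateConst aA θ d γ * (N : ℝ) ^ (-γ) + nearPosConst aA d γ * δ ^ γ)
            * ∑ j ∈ J.erase 0, aliasTerm γ p j := by rw [Finset.mul_sum]
      _ ≤ _ := by
          refine mul_le_mul_of_nonneg_left
            (alias_sum_le_of_subset hd hγ1 hp (Finset.notMem_erase 0 J)) ?_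
          positivity
  have hcentral : g 0 ≤ dcentralRateConst aA θ K d γ * (N : ℝ) ^ (-γ) + dcentralPosConst K d γ * δ ^ γ := by
    simp only [hg, aliasPt_zero']
    exact norm_dmodeTerm_sub_central_le hNr hηB hηBA hM hγ0 hγ1.le hΔA hΔAa hθ hK h43 hp hcen hδ hξ μ
  have hsplit : ∑ j ∈ J, g j ≤ g 0 + ∑ j ∈ J.erase 0, g j := by
    by_cases h0 : (0 : Fin d → ℤ) ∈ J
    · rw [Finset.add_sum_erase J g h0]
    · rw [Finset.erase_eq_of_notMem h0]; linarith [hg0 0]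
  -- ASSEMBLY
  calc (∑ j ∈ J, ∑ b ∈ B.erase 0, ‖dmodeTerm ΔB ((R : ℝ) * N)⁻¹ M (aliasPt p (j + (N : ℤ) • b)) ξ' μ‖)
        + ∑ j ∈ J, g j
      ≤ aB * ((π / 2) ^ d * (π ^ 2 / 4)) * (N : ℝ) ^ (-γ) * aliasConst d γ
        + ((dcentralRateConst aA θ K d γ * (N : ℝ) ^ (-γ) + dcentralPosConst K d γ * δ ^ γ)
          + (dnearRateConst aA θ d γ * (N : ℝ) ^ (-γ) + nearPosConst aA d γ * δ ^ γ) * aliasConst d γ) :=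
        add_le_add hfar (hsplit.trans (add_le_add hcentral hnear))
    _ = dprop38RateConst aA aB θ K d γ * (N : ℝ) ^ (-γ) + dprop38PosConst aA K d γ * δ ^ γ := by
        simp only [dprop38RateConst, dprop38PosConst]; ring

section KingSymbols

open Literature.MathematicalPhysics.QuantumFieldTheory.Balaban1983to89

/-- **PROPOSITION 3.8, MOMENTUM-SPACE CORE OF THE DERIVATIVE LINE, FOR KING'S SYMBOLS.**  With `Δ_A = Δ^{(k)}(p′)`,
`Δ_B = Δ^{(k+n)}(p′)` the effective Laplacians (4.5) of the `L^k`- and `L^{k+n}`-block transformations with King's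
constants `a_k`, `a_{k+n}` ((2.13)), mass `m² > 0`, `L ≥ 2`, `k, n ≥ 1`, a coordinate `μ`: the alias sums of the
two-spacing difference of the mode families of `a_{k+n}∂^{η′}_μG_{k+n}Q_{k+n}^*` at `x′` and `a_k∂^η_μG_kQ_k^*` at `x`
((4.19); digits `2|j_ν| < L^k`, `2|b_ν| < L^n`, `|x′_ν − x_ν| ≤ δ`) are `≤ C₁′·L^{−γk} + C₂′·δ^γ`, uniformly in
`p′ ∈ [−π,π]^d`, the mass and `n`, for every `0 ≤ γ < 1`; at `δ = L^{−k}` this is King's `CL^{−γk}` for the second line of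
(3.71).  Constants: `C₁′ = dprop38RateConst a a θ (π²/4)^d d γ`, `C₂′ = dprop38PosConst a (π²/4)^d d γ`,
`θ = lemma43Const a L k n`. [cite: King1986, Prop. 3.8 (3.71) p.664; (4.19)–(4.31) pp.672–674] -/
theorem king_prop38_deriv_aliasSums {d : ℕ} (hd : 0 < d) {a : ℝ} (ha : 0 < a) {L k n : ℕ} (hL : 2 ≤ L)
    (hk : 1 ≤ k) (hn : 1 ≤ n) {M : ℝ} (hM : 0 < M) {γ : ℝ} (hγ0 : 0 ≤ γ) (hγ1 : γ < 1)
    {p : Fin d → ℝ} (hp : ∀ μ, |p μ| ≤ π)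
    {J B : Finset (Fin d → ℤ)} (hJ : ∀ j ∈ J, ∀ μ, 2 * |j μ| < ((L ^ k : ℕ) : ℤ))
    (hB : ∀ b ∈ B, ∀ μ, 2 * |b μ| < ((L ^ n : ℕ) : ℤ))
    {ξ ξ' : Fin d → ℝ} {δ : ℝ} (hδ : 0 ≤ δ) (hξ : ∀ μ, |ξ' μ - ξ μ| ≤ δ) (μ : Fin d) :
    (∑ j ∈ J, ∑ b ∈ B.erase 0,
        ‖dmodeTerm (DeltaEff (aK a L (k + n)) (L ^ n * L ^ k) M p) (((L ^ n : ℕ) : ℝ) * ((L ^ k : ℕ) : ℝ))⁻¹ M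
          (aliasPt p (j + ((L ^ k : ℕ) : ℤ) • b)) ξ' μ‖)
      + ∑ j ∈ J, ‖dmodeTerm (DeltaEff (aK a L (k + n)) (L ^ n * L ^ k) M p) (((L ^ n : ℕ) : ℝ) * ((L ^ k : ℕ) : ℝ))⁻¹
            M (aliasPt p j) ξ' μ
          - dmodeTerm (DeltaEff (aK a L k) (L ^ k) M p) (((L ^ k : ℕ) : ℝ))⁻¹ M (aliasPt p j) ξ μ‖
      ≤ dprop38RateConst a a (lemma43Const a L k n) ((π ^ 2 / 4) ^ d) d γ * ((L ^ k : ℕ) : ℝ) ^ (-γ)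
        + dprop38PosConst a ((π ^ 2 / 4) ^ d) d γ * δ ^ γ := by
  have hL0 : L ≠ 0 := by omega
  haveI : NeZero (L ^ k) := ⟨pow_ne_zero _ hL0⟩
  have hLr : (1 : ℝ) < L := by exact_mod_cast (lt_of_lt_of_le one_lt_two hL)
  have hNk : 1 ≤ L ^ k := Nat.one_le_pow _ _ (by omega)
  have hNn : 1 ≤ L ^ n := Nat.one_le_pow _ _ (by omega)
  have hΔA0 : 0 ≤ DeltaEff (aK a L k) (L ^ k) M p := DeltaEff_nonneg (aK_pos ha hLr hk).le _ hM.le p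
  have hΔAa : DeltaEff (aK a L k) (L ^ k) M p ≤ a :=
    (DeltaEff_le (aK_pos ha hLr hk) _ hM.le p).trans (aK_le ha hLr hk)
  have hΔB0 : 0 ≤ DeltaEff (aK a L (k + n)) (L ^ n * L ^ k) M p :=
    DeltaEff_nonneg (aK_pos ha hLr (by omega)).le _ hM.le p
  have hΔBa : DeltaEff (aK a L (k + n)) (L ^ n * L ^ k) M p ≤ a :=
    (DeltaEff_le (aK_pos ha hLr (by omega)) _ hM.le p).trans (aK_le ha hLr (by omega))
  have h43 := lemma43_aK_rel ha hL hk hn hM.le hp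
  have hcen := DeltaEff_le_mul_latticeSymbol_of_mass (aK_pos ha hLr hk) hNk hM hp
  exact alias_sums_two_spacing_deriv_le hd hNk hNn hM.le hγ0 hγ1 hΔA0 hΔAa hΔB0 hΔBa
    (lemma43Const_nonneg ha hL hk hn) (by positivity) h43 hp hcen hJ hB hδ hξ μ

end KingSymbols

end Literature.MathematicalPhysics.QuantumFieldTheory.King1986
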